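import Summits.CriticalPhenomena.PercolationContinuityZ3.Theorems.Transplant.BccClawXTable
import HarnessLib

/-!
# The bcc (001)-slabs, exit-form routing certificate III: SOUNDNESS of the planar claw rule (`Prop` forms of `legOK` / `clawX`) and the
# DIAGONAL MIRROR (clip classes with `t_R < 3` are mirror images of classes with `t_R = 3`)

builds on p205010 (kernel theorem, internal audit signed; external expert review pending) — NOT used in this file.
Lane `prim-bschramm`, seat `prim-bschramm-p2` (gen 46; class C1b, METHOD = input substitution; memo `HOME/bschramm/P2-LATTICES.md` §156); helper file
(`--supports stmt-CriticalPhenomena-4575 --as helper`).  «BccClawXTable» defines the first-fit rule `clawX`; «BccClawXTableOK{A,B,C,D}» establish by kernel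
computation that it succeeds on every admissible configuration of the `28` clip classes with `t_R = 3`.  This file
* §1 turns the Boolean tests into propositions: `LegProps` and **`legOK_sound`**, `ClawProps` and **`clawX_sound`** (hub in the rerouting region off the
  targets; three legs — from neighbours of the hub, inside their regions, off the hub and the other targets, simple, `≥ 2` columns, `≥ 3` when `a₁ = a₂`;
  distinct first points; `A ∩ B ⊆ {a₁}` and only when `a₁ = a₂`, `C` disjoint from both);
* §2 proves the MIRROR EQUIVARIANCE of every ingredient under `(x, y) ↦ (y, x)` with the class parameters swapped `(t_R, t_D, s_R, s_D) ↦ (s_R, s_D, t_R, t_D)`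
  (`inDp_sw`, `inRPp_sw`, `isTgt_sw`, `isTgtR_sw`, `stackedExc_sw`, `admissible_sw`) and transports claws back through the mirror (**`ClawProps.unsw`**), so that
  the classes with `t_R < 3` (hence `s_R = 3`) need no kernel theorems of their own («BccClawXLegs»).
[cite: DuminilCopinSidoraviciusTassion2016, §2.3 (proof of Fact 2: the three disjoint paths in B̄_R(z))]
-/

namespace Summit.CriticalPhenomena.PercolationContinuityZ3.Theorems.Transplant

namespace BccClawX

open Literature.Probability.Percolation Literature.Probability.LatticeModels SimpleGraph

/-! ## §1 Soundness of the leg test and of the rule -/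

/-- **The properties of a leg** (the `Prop` form of `legOK R avoid q a l = true`). [folklore] -/
structure LegProps (R : Pt → Bool) (avoid : List Pt) (q a : Pt) (l : List Pt) : Prop where
  /-- non-empty -/
  ne_nil : l ≠ []
  /-- starts next to the hub -/
  head_adj : adjb q (l.head ne_nil) = true
  /-- inside the region -/
  mem_R : ∀ w ∈ l, R w = true
  /-- off the hub -/
  ne_q : ∀ w ∈ l, w ≠ q
  /-- avoids the forbidden points -/
  not_avoid : ∀ w ∈ l, w ∉ avoid
  /-- consecutive points are lattice-adjacent -/
  chain : l.IsChain (fun a b => adjb a b = true)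
  /-- duplicate-free -/
  nodup : l.Nodup
  /-- ends at the target -/
  last : l.getLast ne_nil = a
  /-- at least two columns -/
  two_le : 2 ≤ l.length

/-- `chainb` is `List.IsChain` for `adjb`. [folklore] -/
theorem chainb_iff : ∀ {l : List Pt}, chainb l = true ↔ l.IsChain (fun a b => adjb a b = true)
  | [] => by simp [chainb]
  | [_] => by simp [chainb]
  | a :: b :: l => by
    rw [chainb, Bool.and_eq_true, chainb_iff, List.isChain_cons_cons]

/-- **Soundness of the leg test.** [folklore] -/
theorem legOK_sound {R : Pt → Bool} {avoid : List Pt} {q a : Pt} {l : List Pt} (h : legOK R avoid q a l = true) : LegProps R avoid q a l := by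
  cases l with
  | nil => simp [legOK] at h
  | cons p rest =>
    simp only [legOK, Bool.and_eq_true, beq_iff_eq, Bool.not_eq_true', List.all_eq_true, decide_eq_true_eq] at h
    obtain ⟨⟨⟨⟨⟨hadj, hall⟩, hch⟩, hnd⟩, hlast⟩, hlen⟩ := h
    refine ⟨List.cons_ne_nil _ _, by simpa using hadj, fun w hw => (hall w hw).1.1, fun w hw => ?_, fun w hw => ?_, chainb_iff.1 hch, hnd, ?_, hlen⟩
    · have := (hall w hw).1.2; simpa using this
    · have := (hall w hw).2; simpa using this
    · rw [List.getLast_eq_iff_getLast?_eq_some]; exact hlast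

/-- `disjB` in `Prop` form. [folklore] -/
theorem disjB_sound {shared : Bool} {a : Pt} {l₁ l₂ : List Pt} (h : disjB shared a l₁ l₂ = true) :
    ∀ w ∈ l₁, w ∈ l₂ → shared = true ∧ w = a := by
  intro w hw hw2
  simp only [disjB, List.all_eq_true, Bool.or_eq_true, Bool.and_eq_true, beq_iff_eq, Bool.not_eq_true'] at h
  rcases h w hw with h | h
  · exact h
  · simp [hw2] at h

/-- **The properties of a claw** (the `Prop` form of `clawX … = some (q, l₁, l₂, l₃)`): the hub in the rerouting region off the targets, three legs passing
their tests, `≥ 3` columns for `A, B` when `a₁ = a₂`, distinct first points, the column-disjointness. [folklore] -/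
structure ClawProps (tR tD sR sD : ℕ) (a1 a2 a3 q : Pt) (l1 l2 l3 : List Pt) : Prop where
  /-- hub in the rerouting region -/
  hq : inRPp tR tD sR sD q = true
  /-- hub off the targets -/
  hq1 : q ≠ a1
  /-- hub off the targets -/
  hq2 : q ≠ a2
  /-- hub off the targets -/
  hq3 : q ≠ a3
  /-- leg `A` -/
  leg1 : LegProps (inRPp tR tD sR sD) (if a1 = a2 then [a3] else [a2, a3]) q a1 l1
  /-- leg `B` -/
  leg2 : LegProps (inRPp tR tD sR sD) (if a1 = a2 then [a3] else [a1, a3]) q a2 l2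
  /-- leg `C` -/
  leg3 : LegProps (inDp tD sD) [a1, a2] q a3 l3
  /-- long legs into a shared column -/
  len1 : a1 = a2 → 3 ≤ l1.length
  /-- long legs into a shared column -/
  len2 : a1 = a2 → 3 ≤ l2.length
  /-- distinct ports -/
  h12 : l1.head? ≠ l2.head?
  /-- distinct ports -/
  h31 : l3.head? ≠ l1.head?
  /-- distinct ports -/
  h32 : l3.head? ≠ l2.head?
  /-- `A, B` meet only in a shared target -/
  d12 : ∀ w ∈ l1, w ∈ l2 → a1 = a2 ∧ w = a1
  /-- `C` off `A` -/
  d31 : ∀ w ∈ l3, w ∉ l1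
  /-- `C` off `B` -/
  d32 : ∀ w ∈ l3, w ∉ l2

/-- **Soundness of the rule.** [folklore] -/
theorem clawX_sound {tR tD sR sD : ℕ} {a1 a2 a3 q : Pt} {l1 l2 l3 : List Pt} (h : clawX tR tD sR sD a1 a2 a3 = some (q, l1, l2, l3)) :
    ClawProps tR tD sR sD a1 a2 a3 q l1 l2 l3 := by
  unfold clawX at h
  obtain ⟨q', -, hq'⟩ := List.exists_of_findSome?_eq_some h
  split_ifs at hq' with hcond
  simp only at hq'
  obtain ⟨m1, hm1, h1⟩ := List.exists_of_findSome?_eq_some hq'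
  obtain ⟨m2, hm2, h2⟩ := List.exists_of_findSome?_eq_some h1
  rw [List.mem_filter] at hm1 hm2
  split_ifs at h2 with h12
  simp only [Option.map_eq_some_iff] at h2
  obtain ⟨m3, hm3, hx⟩ := h2
  have hp3 := List.find?_some hm3
  have hm3' := List.mem_of_find?_eq_some hm3
  rw [List.mem_filter] at hm3'
  simp only [Prod.mk.injEq] at hx
  obtain ⟨rfl, rfl, rfl, rfl⟩ := hx
  simp only [Bool.or_eq_true, Bool.not_eq_true', beq_iff_eq, Bool.and_eq_true, decide_eq_true_eq, beq_eq_false_iff_ne, ne_eq,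
    Bool.not_eq_false, not_or] at hcond hm1 hm2 hm3' hp3 h12
  obtain ⟨⟨⟨hcq, hqa1⟩, hqa2⟩, hqa3⟩ := hcond
  have hsame : (a1 == a2) = true ↔ a1 = a2 := beq_iff_eq
  refine ⟨by simpa using hcq, hqa1, hqa2, hqa3, ?_, ?_, legOK_sound hm3'.2, ?_, ?_, fun h => h12.1 h.symm, hp3.1.1.1, hp3.1.1.2, ?_, ?_, ?_⟩
  · convert legOK_sound hm1.2.1 using 2
  · convert legOK_sound hm2.2.1 using 2
  · intro he
    have := hm1.2.2
    rcases this with h | h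
    · exact absurd (hsame.2 he) (by simp [h])
    · exact h
  · intro he
    have := hm2.2.2
    rcases this with h | h
    · exact absurd (hsame.2 he) (by simp [h])
    · exact h
  · intro w hw hw2
    have := disjB_sound h12.2 w hw hw2
    exact ⟨hsame.1 this.1, this.2⟩
  · intro w hw hw1
    have := disjB_sound hp3.1.2 w hw hw1
    simp at this
  · intro w hw hw2
    have := disjB_sound hp3.2 w hw hw2
    simp at this

/-! ## §2 The diagonal mirror (clip classes with `t_R < 3` are mirror images of classes with `t_R = 3`) -/

/-- The diagonal mirror of a column. [folklore] -/
def sw (p : Pt) : Pt := (p.2, p.1)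

/-- `sw` is an involution. [folklore] -/
@[simp] theorem sw_sw (p : Pt) : sw (sw p) = p := rfl

/-- `sw` is injective. [folklore] -/
theorem sw_injective : Function.Injective sw := fun p q h => by rw [← sw_sw p, h, sw_sw]

/-- `sw` on lists is an involution. [folklore] -/
@[simp] theorem map_sw_map_sw (l : List Pt) : (l.map sw).map sw = l := by
  rw [List.map_map]; conv_rhs => rw [← List.map_id l]
  rfl

/-- Adjacency is mirror-invariant. [folklore] -/
theorem adjb_sw (a b : Pt) : adjb (sw a) (sw b) = adjb a b := by
  simp only [adjb, sw]; exact Bool.or_comm _ _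

/-- The block is mirror-equivariant. [folklore] -/
theorem inD_sw (tD sD : ℕ) (w : Pt) : inD tD sD (sw w) = inD sD tD w := by
  rw [Bool.eq_iff_iff]; simp only [inD, sw, Bool.and_eq_true, decide_eq_true_eq]; constructor <;> intro h <;> omega

/-- The corners are mirror-equivariant. [folklore] -/
theorem isCorner_sw (tD sD : ℕ) (w : Pt) : isCorner tD sD (sw w) = isCorner sD tD w := by
  simp only [isCorner, sw]; exact Bool.and_comm _ _

/-- The cleared region is mirror-equivariant. [folklore] -/
theorem inDp_sw (tD sD : ℕ) (w : Pt) : inDp tD sD (sw w) = inDp sD tD w := by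
  rw [inDp, inDp, inD_sw, isCorner_sw]

/-- The rerouting region is mirror-equivariant. [folklore] -/
theorem inRPp_sw (tR tD sR sD : ℕ) (w : Pt) : inRPp tR tD sR sD (sw w) = inRPp sR sD tR tD w := by
  rw [Bool.eq_iff_iff]; simp only [inRPp, Bool.and_eq_true, decide_eq_true_eq]; rw [inDp_sw]
  show (_ ∧ w.2 ≤ _) ∧ w.1 ≤ _ ↔ _
  tauto

/-- The exit window is mirror-equivariant. [folklore] -/
theorem inBigWin_sw (tD sD : ℕ) (w : Pt) : inBigWin tD sD (sw w) = inBigWin sD tD w := by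
  simp only [inBigWin, sw]; exact Bool.and_comm _ _

/-- Exterior columns are mirror-equivariant. [folklore] -/
theorem isExt_sw (tD sD : ℕ) (w : Pt) : isExt tD sD (sw w) = isExt sD tD w := by
  rw [isExt, isExt, inBigWin_sw, inDp_sw]

/-- The neighbours of the mirror image are the mirror images of the neighbours, up to order. [folklore] -/
theorem nbrs_sw_perm (w : Pt) : (nbrs (sw w)).Perm ((nbrs w).map sw) := by
  simp only [nbrs, sw, List.map_cons, List.map_nil]
  exact List.perm_append_comm (l₁ := [(w.2 + 1, w.1), (w.2 - 1, w.1)]) (l₂ := [(w.2, w.1 + 1), (w.2, w.1 - 1)])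

/-- Target columns are mirror-equivariant. [folklore] -/
theorem isTgt_sw (tD sD : ℕ) (w : Pt) : isTgt tD sD (sw w) = isTgt sD tD w := by
  rw [isTgt, isTgt, inDp_sw]
  congr 1
  rw [Bool.eq_iff_iff, List.any_eq_true, List.any_eq_true]
  constructor
  · rintro ⟨x, hx, h⟩
    obtain ⟨y, hy, rfl⟩ := List.mem_map.1 ((nbrs_sw_perm w).mem_iff.1 hx)
    exact ⟨y, hy, by rwa [isExt_sw] at h⟩
  · rintro ⟨y, hy, h⟩
    exact ⟨sw y, (nbrs_sw_perm w).mem_iff.2 (List.mem_map.2 ⟨y, hy, rfl⟩), by rwa [isExt_sw]⟩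

/-- `(0,0)` is mirror-fixed, detected by `==`. [folklore] -/
theorem sw_beq_zero (w : Pt) : (sw w == (0, 0)) = (w == (0, 0)) := by
  rw [Bool.eq_iff_iff]; simp only [beq_iff_eq]
  constructor
  · intro h; rw [← sw_sw w, h]; rfl
  · intro h; rw [h]; rfl

/-- `==` is mirror-invariant. [folklore] -/
theorem sw_beq_sw (a b : Pt) : (sw a == sw b) = (a == b) := by
  rw [Bool.eq_iff_iff]; simp only [beq_iff_eq]; exact sw_injective.eq_iff

/-- Target columns of the rerouting block are mirror-equivariant. [folklore] -/
theorem isTgtR_sw (tR tD sR sD : ℕ) (w : Pt) : isTgtR tR tD sR sD (sw w) = isTgtR sR sD tR tD w := by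
  rw [isTgtR, isTgtR, isTgt_sw, sw_beq_zero]
  rw [Bool.eq_iff_iff]; simp only [sw, Bool.and_eq_true, decide_eq_true_eq]; tauto

/-- The exceptional configurations are mirror-equivariant. [folklore] -/
theorem stackedExc_sw (tR tD sR sD : ℕ) (a1 a2 a3 : Pt) :
    stackedExc tR tD sR sD (sw a1) (sw a2) (sw a3) = stackedExc sR sD tR tD a1 a2 a3 := by
  have hlen : ((nbrs (sw a1)).filter fun n => inRPp tR tD sR sD n && !(n == sw a3)).length =
      ((nbrs a1).filter fun n => inRPp sR sD tR tD n && !(n == a3)).length := by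
    rw [((nbrs_sw_perm a1).filter _).length_eq, List.filter_map, List.length_map]
    congr 2
    funext n
    simp only [Function.comp, inRPp_sw, sw_beq_sw]
  unfold stackedExc
  rw [hlen, sw_beq_sw]

/-- Admissibility is mirror-equivariant. [folklore] -/
theorem admissible_sw (tR tD sR sD : ℕ) (a1 a2 a3 : Pt) :
    admissible tR tD sR sD (sw a1) (sw a2) (sw a3) = admissible sR sD tR tD a1 a2 a3 := by
  simp only [admissible, stackedExc_sw, sw_beq_sw]

/-- **A leg found for the mirrored data mirrors back to a leg** (regions swapped). [folklore] -/
theorem LegProps.unsw {R R' : Pt → Bool} (hR : ∀ w, R (sw w) = R' w) {avoid : List Pt} {q a : Pt} {l : List Pt}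
    (h : LegProps R (avoid.map sw) (sw q) (sw a) l) : LegProps R' avoid q a (l.map sw) := by
  have hne : l.map sw ≠ [] := by simpa using h.ne_nil
  refine ⟨hne, ?_, ?_, ?_, ?_, ?_, h.nodup.map sw_injective, ?_, by simpa using h.two_le⟩
  · have := h.head_adj
    rw [List.head_map, ← adjb_sw, sw_sw]; exact this
  · intro w hw
    obtain ⟨v, hv, rfl⟩ := List.mem_map.1 hw
    rw [← hR, sw_sw]; exact h.mem_R v hv
  · intro w hw
    obtain ⟨v, hv, rfl⟩ := List.mem_map.1 hw
    intro hq; exact h.ne_q v hv (by rw [← hq, sw_sw])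
  · intro w hw hav
    obtain ⟨v, hv, rfl⟩ := List.mem_map.1 hw
    exact h.not_avoid v hv (by rw [← sw_sw v]; exact List.mem_map.2 ⟨sw v, hav, rfl⟩)
  · rw [List.isChain_map]
    exact h.chain.imp fun a b hab => by rwa [adjb_sw]
  · rw [List.getLast_map, h.last, sw_sw]

/-- **A claw found for the mirrored configuration mirrors back to a claw.** [folklore] -/
theorem ClawProps.unsw {tR tD sR sD : ℕ} {a1 a2 a3 q : Pt} {l1 l2 l3 : List Pt}
    (h : ClawProps sR sD tR tD (sw a1) (sw a2) (sw a3) q l1 l2 l3) :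
    ClawProps tR tD sR sD a1 a2 a3 (sw q) (l1.map sw) (l2.map sw) (l3.map sw) := by
  have hiff : sw a1 = sw a2 ↔ a1 = a2 := sw_injective.eq_iff
  have hq : sw (sw q) = q := sw_sw q
  refine ⟨?_, ?_, ?_, ?_, ?_, ?_, ?_, ?_, ?_, ?_, ?_, ?_, ?_, ?_, ?_⟩
  · rw [inRPp_sw]; exact h.hq
  · intro e; exact h.hq1 (by rw [← e]; rfl)
  · intro e; exact h.hq2 (by rw [← e]; rfl)
  · intro e; exact h.hq3 (by rw [← e]; rfl)
  · have e : (if sw a1 = sw a2 then [sw a3] else [sw a2, sw a3]) = (if a1 = a2 then [a3] else [a2, a3]).map sw := by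
      rw [if_congr hiff rfl rfl]; split_ifs <;> rfl
    have h1 := h.leg1
    rw [e, ← hq] at h1
    exact LegProps.unsw (R' := inRPp tR tD sR sD) (fun w => inRPp_sw sR sD tR tD w) h1
  · have e : (if sw a1 = sw a2 then [sw a3] else [sw a1, sw a3]) = (if a1 = a2 then [a3] else [a1, a3]).map sw := by
      rw [if_congr hiff rfl rfl]; split_ifs <;> rfl
    have h2 := h.leg2
    rw [e, ← hq] at h2
    exact LegProps.unsw (R' := inRPp tR tD sR sD) (fun w => inRPp_sw sR sD tR tD w) h2
  · have e : ([sw a1, sw a2] : List Pt) = ([a1, a2] : List Pt).map sw := rfl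
    have h3 := h.leg3
    rw [e, ← hq] at h3
    exact LegProps.unsw (R' := inDp tD sD) (fun w => inDp_sw sD tD w) h3
  · intro e; simpa using h.len1 (hiff.2 e)
  · intro e; simpa using h.len2 (hiff.2 e)
  · intro e; apply h.h12
    rw [List.head?_map, List.head?_map] at e
    exact Option.map_injective sw_injective e
  · intro e; apply h.h31
    rw [List.head?_map, List.head?_map] at e
    exact Option.map_injective sw_injective e
  · intro e; apply h.h32
    rw [List.head?_map, List.head?_map] at e
    exact Option.map_injective sw_injective e
  · intro w hw hw2
    obtain ⟨v, hv, rfl⟩ := List.mem_map.1 hw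
    have hv2 : v ∈ l2 := by
      obtain ⟨u, hu, huv⟩ := List.mem_map.1 hw2
      rw [sw_injective huv] at hu; exact hu
    obtain ⟨e1, e2⟩ := h.d12 v hv hv2
    exact ⟨hiff.1 e1, by rw [e2, sw_sw]⟩
  · intro w hw hw1
    obtain ⟨v, hv, rfl⟩ := List.mem_map.1 hw
    obtain ⟨u, hu, huv⟩ := List.mem_map.1 hw1
    rw [sw_injective huv] at hu
    exact h.d31 v hv hu
  · intro w hw hw2
    obtain ⟨v, hv, rfl⟩ := List.mem_map.1 hw
    obtain ⟨u, hu, huv⟩ := List.mem_map.1 hw2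
    rw [sw_injective huv] at hu
    exact h.d32 v hv hu

end BccClawX

end Summit.CriticalPhenomena.PercolationContinuityZ3.Theorems.Transplant
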